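import Literature.Geometry.Symplectic.TwistingHomotopyProofs
import Literature.Geometry.Symplectic.LegendrianRealisationProofs
import HarnessLib

/-!
# Twisting numbers of conformally related framed Legendrian knots agree

Topic `Literature/Geometry/Symplectic`; first half of the seam-transport invariance of the
twisting number (`SteinSeamTwisting.lean`).  The twisting number
`SteinStructure.twisting S K ν` of a framing `ν` of a Legendrian knot `K` in the boundary of a
compact Stein domain (`SteinBoundaryContact.lean`) is the winding number of the twisting loop
`t ↦ (ω(ċ, ν), α(ν)) ∈ ℂ`, `α = -d^ℂφ` the contact form and `ω = dα` the Kähler form: the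
rotation number of `ν` against the canonical framing `(J ċ, R)` (Gompf 1998, §1: *"A Legendrian
link comes equipped with a canonical framing of its normal bundle … induced by any vector field
transverse to `ξ`, or equivalently, by a vector field in `ξ|L` transverse to `L`"*; Geiges 2008,
Def. 3.5.4: the Thurston–Bennequin invariant as the twisting of the contact framing).

This file proves the winding-number heart of the statement *"a contactomorphism which rescales
the contact forms by a factor `f` of constant sign carries twisting numbers to twisting
numbers"*, in the pointwise form in which the seam of a Stein bisection delivers it:

* `Literature.Topology.PlaneTopology.wind_eq_of_div_mem_slitPlane` — **two loops in `ℂ ∖ 0`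
  whose quotient avoids the negative real axis have the same winding number** (the quotient
  has the principal logarithm as a periodic logarithm; dog-on-a-leash form of Rouché);
* `Literature.Topology.PlaneTopology.div_mem_slitPlane_of_conformal` — the pointwise criterion:
  if `w.im = f · z.im` and, when `z` is real, `w.re = f · z.re`, with `f > 0` and `z ≠ 0`, then
  `z / w` avoids the negative real axis;
* `twisting_eq_of_conformal` — **if along two framed Legendrian knots `(Λ, ν₁)` in `∂W₁` and
  `(β, ν₂)` in `∂W₂` one has `α₂(ν₂) = f · α₁(ν₁)` and, wherever `ν₁ ∈ ξ₁` and `ν₂ ∈ ξ₂`,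
  `ω₂(β̇, ν₂) = f · ω₁(Λ̇, ν₁)`, for a factor `f` of constant sign, then
  `twisting Λ ν₁ = twisting β ν₂`**: the two twisting loops (or one and the negative of the
  other) never point in opposite directions;
* `twisting_eq_of_seamTransport_of_conformalFactor` — the same for two knots matched by a pair
  of maps `e₁ : W₁ → X`, `e₂ : W₂ → X` (`e₁ ∘ Λ = e₂ ∘ β`, `de₁ ν₁ = de₂ ν₂`) under the
  hypothesis that along the knot the seam transport `de₂⁻¹ ∘ de₁` rescales the contact forms on
  `T∂W` and the Kähler forms `ω(ċ, ·)` on `ξ` by a common factor `f` of constant sign — the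
  **conformal factor of the seam contactomorphism**, which `SteinSeamTwisting.lean` produces
  from the matching of the complex tangencies (`ψ^*α₂ = f α₁` forces `ψ^*dα₂|_ξ = f dα₁|_ξ`);
* `isLegendrianKnot_of_seamTransport` — Legendrian knots transport across such a seam.

Design: no orientation of `X` and no two-sidedness enter here; the sign discussion of the
complex boundary orientations is entirely encoded in the constancy of the sign of `f`, and
both signs give the same conclusion (reversing the co-orientation of `ξ` together with its
orientation preserves rotation numbers).

## References

* R. E. Gompf, *Handlebody construction of Stein surfaces*, Ann. of Math. 148 (1998), §1.
  [Gompf1998]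
* H. Geiges, *An Introduction to Contact Topology*, CUP (2008), Def. 2.1.5, Def. 3.5.4.
  [Geiges2008]
-/

noncomputable section

open scoped Manifold ContDiff Topology
open Set Function

/-! ### Plane topology: loops whose quotient avoids the negative real axis -/

namespace Literature.Topology.PlaneTopology

open Complex

/-- Two complex numbers in the open upper half plane have a quotient off the closed negative
real axis. [folklore] -/
theorem div_mem_slitPlane_of_im_pos {z w : ℂ} (hz : 0 < z.im) (hw : 0 < w.im) :
    z / w ∈ slitPlane := by
  have hw0 : w ≠ 0 := by
    rintro rfl
    simp at hw
  rw [mem_slitPlane_iff_not_le_zero, Complex.le_def]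
  rintro ⟨hre, him⟩
  have hz' : z = z / w * w := (div_mul_cancel₀ z hw0).symm
  have key : z.im = (z / w).re * w.im + (z / w).im * w.re := by
    conv_lhs => rw [hz']
    exact mul_im _ _
  rw [him, zero_im, zero_mul, add_zero] at key
  rw [zero_re] at hre
  nlinarith

/-- Two complex numbers in the open lower half plane have a quotient off the closed negative
real axis. [folklore] -/
theorem div_mem_slitPlane_of_im_neg {z w : ℂ} (hz : z.im < 0) (hw : w.im < 0) :
    z / w ∈ slitPlane := by
  have h := div_mem_slitPlane_of_im_pos (z := -z) (w := -w) (by simpa using hz) (by simpa using hw)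
  rwa [neg_div_neg_eq] at h

/-- Two real numbers of the same sign have a quotient off the closed negative real axis.
[folklore] -/
theorem div_mem_slitPlane_of_im_eq_zero {z w : ℂ} (hz : z.im = 0) (hw : w.im = 0)
    (h : 0 < z.re * w.re) : z / w ∈ slitPlane := by
  have hw0 : w ≠ 0 := by
    rintro rfl
    simp at h
  refine mem_slitPlane_iff.2 (Or.inl ?_)
  rw [div_re, hz, hw, mul_zero, zero_div, add_zero]
  exact div_pos h (normSq_pos.2 hw0)

/-- **Pointwise conformality criterion.**  If `w.im = f · z.im`, and `w.re = f · z.re` whenever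
`z` is real, for a positive factor `f` and `z ≠ 0`, then `z / w` avoids the closed negative real
axis. [folklore] -/
theorem div_mem_slitPlane_of_conformal {z w : ℂ} {f : ℝ} (hf : 0 < f) (hz : z ≠ 0)
    (him : w.im = f * z.im) (hre : z.im = 0 → w.re = f * z.re) : z / w ∈ slitPlane := by
  rcases lt_trichotomy 0 z.im with h | h | h
  · exact div_mem_slitPlane_of_im_pos h (by rw [him]; positivity)
  · have hzre : z.re ≠ 0 := fun h0 => hz (Complex.ext h0 h.symm)
    refine div_mem_slitPlane_of_im_eq_zero h.symm (by rw [him, ← h, mul_zero]) ?_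
    rw [hre h.symm, mul_left_comm]
    exact mul_pos hf (mul_self_pos.2 hzre)
  · exact div_mem_slitPlane_of_im_neg h (by rw [him]; exact mul_neg_of_pos_of_neg hf h)

/-- **Loops whose quotient avoids the negative real axis have the same winding number**
(dog-on-a-leash form of Rouché's principle): the quotient loop has the principal logarithm,
continuous off the negative real axis, as a periodic logarithm, so `wind (f / g) = 0`
(`wind_eq_zero_iff`), and `wind (f / g) = wind f - wind g` (`wind_div`). [folklore] -/
theorem wind_eq_of_div_mem_slitPlane {f g : ℝ → ℂ} (hf : IsNonvanishingLoop f)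
    (hg : IsNonvanishingLoop g) (h : ∀ t ∈ Icc (0 : ℝ) 1, f t / g t ∈ slitPlane) :
    wind f = wind g := by
  have hq : IsNonvanishingLoop fun t => f t / g t := hf.div hg
  have h0 : wind (fun t => f t / g t) = 0 := by
    rw [wind_eq_zero_iff hq]
    refine ⟨fun t => log (f t / g t), fun t ht => ?_, fun t ht => exp_log (hq.ne_zero t ht), ?_⟩
    · exact (hq.continuousOn t ht).clog (h t ht)
    · show log (f 0 / g 0) = log (f 1 / g 1)
      rw [hf.eq_endpoints, hg.eq_endpoints]
  have h1 := wind_div hf hg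
  omega

end Literature.Topology.PlaneTopology

namespace Literature.Geometry.Symplectic

open Literature.Topology.FourManifolds Literature.Topology.PlaneTopology

/-- The model vector space `ℝ⁴` of the tangent spaces. [folklore] -/
local notation "E4" => EuclideanSpace ℝ (Fin 4)

/-- Local notation: `𝕊 n` is the unit sphere in `EuclideanSpace ℝ (Fin (n + 1))`. -/
local notation "𝕊 " n:arg => (Metric.sphere (0 : EuclideanSpace ℝ (Fin (n + 1))) 1)

variable {W₁ : Type*} [TopologicalSpace W₁] [ChartedSpace (EuclideanHalfSpace 4) W₁]
  [IsManifold (𝓡∂ 4) ∞ W₁] [CompactSpace W₁]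
  {W₂ : Type*} [TopologicalSpace W₂] [ChartedSpace (EuclideanHalfSpace 4) W₂]
  [IsManifold (𝓡∂ 4) ∞ W₂] [CompactSpace W₂]

/-! ### The twisting loop of a framing of a Legendrian knot is a loop in `ℂ ∖ 0` -/

/-- The twisting loop of a framing of a Legendrian knot, read on `[0, 1]`, is a loop in
`ℂ ∖ 0` (`IsKnotFraming.continuous_twistingLoop`, `IsKnotFraming.twistingLoop_ne_zero`,
`SteinStructure.twistingLoop_add_one`). [cite: Gompf1998, §1] -/
theorem IsKnotFraming.isNonvanishingLoop_twistingLoop [T2Space W₁] {S : SteinStructure W₁}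
    {K : 𝕊 1 → W₁} {ν : 𝕊 1 → E4} (hν : IsKnotFraming K ν) (hK : IsLegendrianKnot S.J K) :
    IsNonvanishingLoop (S.twistingLoop K ν) := by
  have hKd : MDifferentiable (𝓡 1) (𝓡∂ 4) K :=
    hK.isSmoothEmbedding.contMDiff.mdifferentiable (by simp)
  refine ⟨(hν.continuous_twistingLoop hK).continuousOn, fun t _ => hν.twistingLoop_ne_zero hK t,
    ?_⟩
  have h := S.twistingLoop_add_one hKd ν 0
  rw [zero_add] at h
  exact h.symm

/-- The negative of the twisting loop is again a loop in `ℂ ∖ 0` with the same winding number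
(`wind (-1) = 0`). [folklore] -/
theorem IsKnotFraming.wind_neg_twistingLoop [T2Space W₁] {S : SteinStructure W₁}
    {K : 𝕊 1 → W₁} {ν : 𝕊 1 → E4} (hν : IsKnotFraming K ν) (hK : IsLegendrianKnot S.J K) :
    IsNonvanishingLoop (fun t => -S.twistingLoop K ν t) ∧
      wind (fun t => -S.twistingLoop K ν t) = wind (S.twistingLoop K ν) := by
  have hL := hν.isNonvanishingLoop_twistingLoop hK
  have hc : IsNonvanishingLoop fun _ : ℝ => (-1 : ℂ) := IsNonvanishingLoop.const (by norm_num)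
  have heq : (fun t => -S.twistingLoop K ν t) = fun t => (-1 : ℂ) * S.twistingLoop K ν t :=
    funext fun t => (neg_one_mul _).symm
  rw [heq]
  exact ⟨hc.mul hL, by rw [wind_mul hc hL, wind_const, zero_add]⟩

/-! ### Conformally related framed Legendrian knots have the same twisting number -/

/-- **Twisting numbers of conformally related framed Legendrian knots agree.**  Let `Λ` be a
Legendrian knot in `∂W₁` with framing `ν₁` and `β` a Legendrian knot in `∂W₂` with framing `ν₂`
(Stein domains `(W₁, J₁)`, `(W₂, J₂)`), and let `f : ℝ → ℝ` have constant sign along the unit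
parametrisation.  If at every parameter `t` the contact forms of the framings are related by
`α₂(ν₂) = f t · α₁(ν₁)`, and — at the parameters where both framings are tangent to the contact
planes — the Kähler pairings with the velocities by `ω₂(β̇, ν₂) = f t · ω₁(Λ̇, ν₁)`, then
`twisting Λ ν₁ = twisting β ν₂`.  Indeed the twisting loops `(ω₁(Λ̇, ν₁), α₁(ν₁))` and
`±(ω₂(β̇, ν₂), α₂(ν₂))` (sign of `f`) then never point in opposite directions
(`div_mem_slitPlane_of_conformal`: `α₁(ν₁) = 0` forces `ν₁ ∈ ξ₁`, and then `α₂(ν₂) = 0` forces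
`ν₂ ∈ ξ₂`), so they have the same winding number (`wind_eq_of_div_mem_slitPlane`); reversing
both the co-orientation and the orientation of the contact planes (`f < 0`) does not change
rotation numbers.  This is the computational content of "a co-orientation class of
contactomorphism preserves the twisting of framings relative to the contact framing"
(Gompf 1998, §1; Geiges 2008, Def. 3.5.4). [cite: Gompf1998, §1] -/
theorem twisting_eq_of_conformal [T2Space W₁] [T2Space W₂] (J₁ : SteinStructure W₁)
    (J₂ : SteinStructure W₂) {Λ : 𝕊 1 → W₁} {β : 𝕊 1 → W₂} {ν₁ ν₂ : 𝕊 1 → E4}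
    (hΛ : IsLegendrianKnot J₁.J Λ) (hβ : IsLegendrianKnot J₂.J β) (hν₁ : IsKnotFraming Λ ν₁)
    (hν₂ : IsKnotFraming β ν₂) (f : ℝ → ℝ) (hf : (∀ t, 0 < f t) ∨ (∀ t, f t < 0))
    (hα : ∀ t : ℝ, J₂.contactForm (β (circlePt t)) (ν₂ (circlePt t)) =
      f t * J₁.contactForm (Λ (circlePt t)) (ν₁ (circlePt t)))
    (hω : ∀ t : ℝ, ν₁ (circlePt t) ∈ contactPlane J₁.J (Λ (circlePt t)) →
      ν₂ (circlePt t) ∈ contactPlane J₂.J (β (circlePt t)) →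
      J₂.kahlerForm (β (circlePt t)) (knotVelocity β t) (ν₂ (circlePt t)) =
        f t * J₁.kahlerForm (Λ (circlePt t)) (knotVelocity Λ t) (ν₁ (circlePt t))) :
    J₁.twisting Λ ν₁ = J₂.twisting β ν₂ := by
  have hL₁ := hν₁.isNonvanishingLoop_twistingLoop hΛ
  have hL₂ := hν₂.isNonvanishingLoop_twistingLoop hβ
  -- the real parts are related wherever the first loop is real
  have hre : ∀ t : ℝ, (J₁.twistingLoop Λ ν₁ t).im = 0 →
      (J₂.twistingLoop β ν₂ t).re = f t * (J₁.twistingLoop Λ ν₁ t).re := by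
    intro t him
    have him₁ : J₁.contactForm (Λ (circlePt t)) (ν₁ (circlePt t)) = 0 := him
    have h₁ : ν₁ (circlePt t) ∈ contactPlane J₁.J (Λ (circlePt t)) :=
      J₁.mem_contactPlane_of_contactForm_eq_zero (hΛ.isBoundaryPoint _)
        (hν₁.mem_boundaryTangentSpace _) him₁
    have him₂ : J₂.contactForm (β (circlePt t)) (ν₂ (circlePt t)) = 0 := by
      rw [hα t, him₁, mul_zero]
    have h₂ : ν₂ (circlePt t) ∈ contactPlane J₂.J (β (circlePt t)) :=
      J₂.mem_contactPlane_of_contactForm_eq_zero (hβ.isBoundaryPoint _)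
        (hν₂.mem_boundaryTangentSpace _) him₂
    exact hω t h₁ h₂
  show wind (J₁.twistingLoop Λ ν₁) = wind (J₂.twistingLoop β ν₂)
  rcases hf with hpos | hneg
  · refine wind_eq_of_div_mem_slitPlane hL₁ hL₂ fun t _ => ?_
    exact div_mem_slitPlane_of_conformal (hpos t) (hν₁.twistingLoop_ne_zero hΛ t) (hα t) (hre t)
  · obtain ⟨hL₂', hw⟩ := hν₂.wind_neg_twistingLoop hβ
    rw [← hw]
    refine wind_eq_of_div_mem_slitPlane hL₁ hL₂' fun t _ => ?_
    refine div_mem_slitPlane_of_conformal (f := -f t) (neg_pos.2 (hneg t))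
      (hν₁.twistingLoop_ne_zero hΛ t) ?_ fun him => ?_
    · rw [Complex.neg_im, neg_mul]
      exact congrArg Neg.neg (hα t)
    · rw [Complex.neg_re, hre t him, neg_mul]

/-! ### The seam form: transport by a pair of maps into a common manifold -/

variable {X : Type*}

/-- **Seam transport with a conformal factor preserves the twisting number.**  Let
`e₁ : W₁ → X`, `e₂ : W₂ → X` be maps (in the application: the two halves of a Stein bisection of
a `4`-manifold `X`), `Λ`, `β` Legendrian knots in `∂W₁`, `∂W₂` with `e₁ ∘ Λ = e₂ ∘ β` whose
framings `ν₁`, `ν₂` correspond under the differentials, `de₁ ν₁ = de₂ ν₂`.  Suppose that along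
the knot the seam transport `de₂⁻¹ de₁` rescales the contact forms on `T∂W` and the Kähler
pairings `ω(ċ, ·)` on the contact planes by one factor `f t` of constant sign:
`α₂(u₂) = f t · α₁(u₁)` for boundary-tangent `u₁`, `u₂` with `de₁ u₁ = de₂ u₂`, and
`ω₂(β̇, v₂) = f t · ω₁(Λ̇, v₁)` for `vᵢ ∈ ξᵢ` with `de₁ v₁ = de₂ v₂` — the conformal factor of
the seam contactomorphism `ψ`, `ψ^*α₂ = f α₁` (whence `ψ^*dα₂|_ξ = f dα₁|_ξ`), produced from
the matching of the complex tangencies in `SteinSeamTwisting.lean`.  Then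
`twisting Λ ν₁ = twisting β ν₂` (`twisting_eq_of_conformal`).  Gompf (1998), §1 (the canonical
framing is contact-invariant); Geiges (2008), Def. 2.1.5 / Def. 3.5.4. [cite: Gompf1998, §1] -/
theorem twisting_eq_of_seamTransport_of_conformalFactor [T2Space W₁] [T2Space W₂]
    [TopologicalSpace X] [ChartedSpace (EuclideanSpace ℝ (Fin 4)) X]
    (J₁ : SteinStructure W₁) (J₂ : SteinStructure W₂) {e₁ : W₁ → X} {e₂ : W₂ → X}
    {Λ : 𝕊 1 → W₁} {β : 𝕊 1 → W₂} {ν₁ ν₂ : 𝕊 1 → E4}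
    (hΛ : IsLegendrianKnot J₁.J Λ) (hβ : IsLegendrianKnot J₂.J β)
    (hν₁ : IsKnotFraming Λ ν₁) (hν₂ : IsKnotFraming β ν₂)
    (hν : ∀ u, mfderiv (𝓡∂ 4) (𝓡 4) e₁ (Λ u) (ν₁ u) = mfderiv (𝓡∂ 4) (𝓡 4) e₂ (β u) (ν₂ u))
    (f : ℝ → ℝ) (hf : (∀ t, 0 < f t) ∨ (∀ t, f t < 0))
    (hfα : ∀ (t : ℝ) (u₁ u₂ : E4), u₁ ∈ boundaryTangentSpace → u₂ ∈ boundaryTangentSpace →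
      mfderiv (𝓡∂ 4) (𝓡 4) e₁ (Λ (circlePt t)) u₁ = mfderiv (𝓡∂ 4) (𝓡 4) e₂ (β (circlePt t)) u₂ →
      J₂.contactForm (β (circlePt t)) u₂ = f t * J₁.contactForm (Λ (circlePt t)) u₁)
    (hfω : ∀ (t : ℝ) (v₁ v₂ : E4), v₁ ∈ contactPlane J₁.J (Λ (circlePt t)) →
      v₂ ∈ contactPlane J₂.J (β (circlePt t)) →
      mfderiv (𝓡∂ 4) (𝓡 4) e₁ (Λ (circlePt t)) v₁ = mfderiv (𝓡∂ 4) (𝓡 4) e₂ (β (circlePt t)) v₂ →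
      J₂.kahlerForm (β (circlePt t)) (knotVelocity β t) v₂ =
        f t * J₁.kahlerForm (Λ (circlePt t)) (knotVelocity Λ t) v₁) :
    J₁.twisting Λ ν₁ = J₂.twisting β ν₂ :=
  twisting_eq_of_conformal J₁ J₂ hΛ hβ hν₁ hν₂ f hf
    (fun t => hfα t _ _ (hν₁.mem_boundaryTangentSpace _) (hν₂.mem_boundaryTangentSpace _) (hν _))
    (fun t h₁ h₂ => hfω t _ _ h₁ h₂ (hν _))

/-! ### Legendrian knots transport across the seam -/

/-- **Legendrian knots transport across the seam of a Stein bisection.**  Let `e₁ : W₁ → X`,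
`e₂ : W₂ → X` be smooth embeddings whose images meet in `e₁(∂W₁)` and whose pushed-forward
complex tangencies agree at common points.  If `Λ : S¹ → W₁` is a smooth embedding with
`e₁ ∘ Λ = e₂ ∘ β` for a Legendrian knot `β` in `∂W₂`, then `Λ` is a Legendrian knot in `∂W₁`:
its points are seam points, hence boundary points, and by the chain rule
`de₁ (dΛ w) = de₂ (dβ w) ∈ de₂ ξ₂ = de₁ ξ₁`, with `de₁` injective (immersion).
Geiges (2008), §2.1 (contactomorphisms carry Legendrian curves to Legendrian curves).
[cite: Geiges2008, Def. 2.1.5] -/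
theorem isLegendrianKnot_of_seamTransport [TopologicalSpace X]
    [ChartedSpace (EuclideanSpace ℝ (Fin 4)) X] [IsManifold (𝓡 4) ∞ X]
    (J₁ : SteinStructure W₁) (J₂ : SteinStructure W₂) {e₁ : W₁ → X} {e₂ : W₂ → X}
    (h1 : Manifold.IsSmoothEmbedding (𝓡∂ 4) (𝓡 4) ∞ e₁)
    (h2 : Manifold.IsSmoothEmbedding (𝓡∂ 4) (𝓡 4) ∞ e₂)
    (hL : range e₁ ∩ range e₂ = e₁ '' (𝓡∂ 4).boundary W₁)
    (hC : ∀ w₁ w₂, e₁ w₁ = e₂ w₂ →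
      Submodule.map (mfderiv (𝓡∂ 4) (𝓡 4) e₁ w₁).toLinearMap (contactPlane J₁.J w₁) =
        Submodule.map (mfderiv (𝓡∂ 4) (𝓡 4) e₂ w₂).toLinearMap (contactPlane J₂.J w₂))
    {Λ : 𝕊 1 → W₁} {β : 𝕊 1 → W₂} (hΛ : Manifold.IsSmoothEmbedding (𝓡 1) (𝓡∂ 4) ∞ Λ)
    (hβ : IsLegendrianKnot J₂.J β) (hΛβ : ∀ u, e₁ (Λ u) = e₂ (β u)) :
    IsLegendrianKnot J₁.J Λ := by
  -- adapted from the design scratch of `stub_upsideDownLegendrianDual` (glue G1)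
  refine ⟨hΛ, fun u => ?_, fun u w => ?_⟩
  · have hp : e₁ (Λ u) ∈ range e₁ ∩ range e₂ := ⟨mem_range_self _, (hΛβ u) ▸ mem_range_self _⟩
    rw [hL] at hp
    obtain ⟨x, hx, hxe⟩ := hp
    rw [h1.isEmbedding.injective hxe] at hx
    exact hx
  · have hmap := hC (Λ u) (β u) (hΛβ u)
    have he₁ : MDifferentiableAt (𝓡∂ 4) (𝓡 4) e₁ (Λ u) :=
      (h1.contMDiff (Λ u)).mdifferentiableAt (by simp)
    have he₂ : MDifferentiableAt (𝓡∂ 4) (𝓡 4) e₂ (β u) :=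
      (h2.contMDiff (β u)).mdifferentiableAt (by simp)
    have hΛd : MDifferentiableAt (𝓡 1) (𝓡∂ 4) Λ u := (hΛ.contMDiff u).mdifferentiableAt (by simp)
    have hβd : MDifferentiableAt (𝓡 1) (𝓡∂ 4) β u :=
      (hβ.isSmoothEmbedding.contMDiff u).mdifferentiableAt (by simp)
    have hfun : e₁ ∘ Λ = e₂ ∘ β := funext hΛβ
    have c1 : mfderiv (𝓡 1) (𝓡 4) (e₁ ∘ Λ) u w =
        mfderiv (𝓡∂ 4) (𝓡 4) e₁ (Λ u) (mfderiv (𝓡 1) (𝓡∂ 4) Λ u w) := by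
      rw [mfderiv_comp u he₁ hΛd]; rfl
    have c2 : mfderiv (𝓡 1) (𝓡 4) (e₂ ∘ β) u w =
        mfderiv (𝓡∂ 4) (𝓡 4) e₂ (β u) (mfderiv (𝓡 1) (𝓡∂ 4) β u w) := by
      rw [mfderiv_comp u he₂ hβd]; rfl
    have hchain : mfderiv (𝓡∂ 4) (𝓡 4) e₁ (Λ u) (mfderiv (𝓡 1) (𝓡∂ 4) Λ u w) =
        mfderiv (𝓡∂ 4) (𝓡 4) e₂ (β u) (mfderiv (𝓡 1) (𝓡∂ 4) β u w) := by
      rw [← c1, ← c2, hfun]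
    have hmem : mfderiv (𝓡∂ 4) (𝓡 4) e₂ (β u) (mfderiv (𝓡 1) (𝓡∂ 4) β u w) ∈
        Submodule.map (mfderiv (𝓡∂ 4) (𝓡 4) e₂ (β u)).toLinearMap (contactPlane J₂.J (β u)) :=
      Submodule.mem_map_of_mem (hβ.mfderiv_mem u w)
    rw [← hmap, ← hchain] at hmem
    obtain ⟨v, hv, hvw⟩ := hmem
    have hinj : Injective (mfderiv (𝓡∂ 4) (𝓡 4) e₁ (Λ u)) :=
      Manifold.IsImmersionAt.mfderiv_injective (h1.isImmersion.isImmersionAt (Λ u)) (by simp)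
    rw [← hinj hvw]
    exact hv

end Literature.Geometry.Symplectic

end
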